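/-
Copyright (c) 2026 the pub-hodgecm-mathlib formalisation cell (harness21).  Prover seat hodgecm-mathlib-LH4-p08 (g3), req620 Track A «(D-RAM) FOUR-FRAME» squad
(heir LEAD F0P3a-plan lineage; dealer LH4-plan (g11) WORD #26 (2); MS ROAD A, Stage B₂ brick B56₂-MULT INPUT, FILE G2-B: the COUNT (P4) of the type-2 polarisation classes of the
glued frame — `polarisationCount = q ∕ 1`; mathematics owed by LH4-p09 (g2)).  2026-09-04.
-/
import Summits.HodgeConjecture.HodgeConjecture.Theorems.F0P3cDyRamDiagonalGluedPolarisationClassesTypeTwo  -- FILE G2-A2 (this seat, ★ p856439): `exists_stabiliser_iff_v_fParam_sub_le`; brings G2-A1 ★ p856415, ★ p856270 (explicit form), ★ p856076, ★ B1 `relIndex_fixedBall_step`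
import Summits.HodgeConjecture.HodgeConjecture.Theorems.F0P3cDyRamDiagonalStrataDefs                      -- ★ DEFS LEAF ED. 3 (LH4-p11 (g2), p856283): `polarisationCosets`, `polarisationCount`
import Mathlib.GroupTheory.QuotientGroup.Basic
import HarnessLib

/-!
# Crux `H413`, MS ROAD A, STAGE B₂ brick B56₂-MULT, FILE G2-B: «THE TYPE-2 MULTIPLICITY OF THE GLUED STRATUM — `polarisationCount = q` (`ρ` EVEN), `= 1` (`ρ` ODD)»

Cell `hodgecm-mathlib` (D-0151), FLOOR 0, crux item H413 = `stmt-HodgeConjecture-24833`; lane `--supports stmt-HodgeConjecture-24833 --as helper` (count-neutral).  THEOREMS ONLY.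
The re-keyed type-2 half of (MS) (LH4-p09 (g2) flag 2026-09-04T00:42:58Z; LH4-p10 (g2) 00:58:37Z; dealer WORD #21∕#26; LEAD (R-21)) weights each lattice by
`polarisationCount σ ϖ 2 M = #(Δ₂(M) ∕ S_F(M))` (★ StrataDefs ED. 3).  THIS FILE computes it on the glued type-2 frame `V = (1 0 0; x ϖ^ρ 0; xζ+y″ ϖ^ρζ ϖ^{2ρ+1+s})` (`|x| = |ζ| = 1`,
`|y″| = |ϖ|^s`, `ρ ≥ 1`, `s` even `≥ 2`) over a ramified quadratic datum with finite residue field, whenever (R) holds for some fixed `f₀` (LH4-p09 (g2)'s owed item (P4)):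
* §1 coset algebra (`mem_coset_self`, `coset_eq_of_exists`) — the `S_F`-classes `D·S_F(M)`.
* §2 THE CLASS MAP: `a ↦ D(f₀ + a)·S_F(latt V)` from the fixed ball `B_F(ρ+s) = F ∩ 𝔭^{ρ+s}` (★ B1's ball currency `leAddSubgroup ⊓ ker(σ − id)`), `D(f)` the EXPLICIT FORM of ★ p856270 §3, is
  constant on cosets of `B_F(ρ+s+1)` and induces a BIJECTION `B_F(ρ+s) ⧸ B_F(ρ+s+1) ≃ polarisationCosets σ ϖ 2 (latt V)` — injective and well defined by FILE G2-A2's criterion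
  `(∃ u ∈ S_F, D′ = D·u) ↔ |f_D − f_{D′}| ≤ |ϖ|^{ρ+s+1}`, surjective because every polarisation `D` has an (R)-parameter `f_D ∈ f₀ + B_F(ρ+s)` (G2-A1) and `f_{D(f)} = f`:
  **`polarisationCount_latt_glued_typeTwo_eq_relIndex`** — `polarisationCount σ ϖ 2 (latt V) = [B_F(ρ+s) : B_F(ρ+s+1)]`.
* §3 THE VALUES (★ B1 `relIndex_fixedBall_step` + parity `fixedBall_inf_odd_eq`): `[B_F(n) : B_F(n+1)] = q` for `n` even, `= 1` for `n` odd, hence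
  **`polarisationCount_latt_glued_typeTwo_eq_card`** (`ρ` even: `= Nat.card 𝓀[K] = q`) and **`polarisationCount_latt_glued_typeTwo_eq_one`** (`ρ` odd: `= 1`) — LH4-p09 (g2)'s table
  (★ p856297 exhibited two of the `q` classes), LH4-r01 (g3) DV∕DX tables «=» at `q = 2, 4`; and `polarisationCount_latt_glued_typeTwo_eq_zero` off (R) (★ p856270 criterion).
HONEST LABEL.  Count-neutral; the census laws stay PROVER TARGETS until the MS assembly lands; `HC_CM` is proved only modulo the 7 printed citations (2 remaining named inputs:
hLiu418 = `stmt-HodgeConjecture-24832`, h413 = `stmt-HodgeConjecture-24833`) until rung 0 closes.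

## References
* [Kottwitz1986BaseChangeUnits] R. Kottwitz, *Base change for unit elements of Hecke algebras*, Compositio Math. 60 (1986), §1 pp. 240–241 (fixed-lattice counting, torus stabilisers).
* [Jacobowitz1962] R. Jacobowitz, *Hermitian forms over local fields*, Amer. J. Math. 84 (1962), §7 (modular lattices and their Gram matrices).
* [Serre1979] J.-P. Serre, *Local Fields*, GTM 67 (1979), Ch. II §2 Prop. 3, Cor. 2–3 (pp. 28–29), Ch. I §6 Prop. 18 (the filtration of a totally ramified quadratic extension seen from the fixed field).
-/

set_option autoImplicit false

noncomputable section

namespace Summit.HodgeConjecture.HodgeConjecture.Cruxes.H413.F0P3cDyRamDiagonalGluedPolarisationCountTypeTwo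

open Matrix
open Literature.NumberTheory.Automorphic Literature.NumberTheory.Automorphic.HermitianLattice Literature.NumberTheory.Automorphic.UnitaryGroup
open Literature.NumberTheory.Automorphic.UnitaryLatticeTree
open Literature.NumberTheory.LocalFields.WildQuadraticDatum
open Summit.HodgeConjecture.HodgeConjecture.Cruxes.H413.F0P3cDyRamDiagonalTorusDefs
open Summit.HodgeConjecture.HodgeConjecture.Cruxes.H413.F0P3cDyRamDiagonalStrataDefs
open Summit.HodgeConjecture.HodgeConjecture.Cruxes.H413.F0P3cDyRamDiagonalGluedTubeCriterionTypeTwo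
open Summit.HodgeConjecture.HodgeConjecture.Cruxes.H413.F0P3cDyRamDiagonalGluedStabiliserIndex
open Summit.HodgeConjecture.HodgeConjecture.Cruxes.H413.F0P3cDyRamDiagonalGluedPolarisationStructureTypeTwo
open Summit.HodgeConjecture.HodgeConjecture.Cruxes.H413.F0P3cDyRamDiagonalGluedPolarisationClassesTypeTwo
open scoped Valued WithZero Matrix MatrixGroups

variable {K : Type*} [Field K] [Valued K ℤᵐ⁰]

/-! ## §1  Coset algebra for the classes `D·S_F(M)` -/

/-- `D` lies in its own class `D·S_F(M)` (`u = 1`). [cite: Kottwitz1986BaseChangeUnits, §1 pp. 240–241] -/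
theorem mem_coset_self {N : ℕ} (σ : K →+* K) (M : Submodule 𝒪[K] (Fin N → K)) (D : Fin N → K) :
    D ∈ {D' : Fin N → K | ∃ u ∈ fixedUnitStabilizer σ M, ∀ i, D' i = D i * ((u i : Kˣ) : K)} :=
  ⟨1, one_mem _, fun i => by rw [Pi.one_apply, Units.val_one, mul_one]⟩

/-- Related forms have the same class: if `D′ = D·u` with `u ∈ S_F(M)` then `D′·S_F(M) = D·S_F(M)` (`S_F(M)` is a group). [cite: Kottwitz1986BaseChangeUnits, §1 pp. 240–241] -/
theorem coset_eq_of_exists {N : ℕ} (σ : K →+* K) (M : Submodule 𝒪[K] (Fin N → K)) {D D' : Fin N → K}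
    (h : ∃ u ∈ fixedUnitStabilizer σ M, ∀ i, D' i = D i * ((u i : Kˣ) : K)) :
    {D'' : Fin N → K | ∃ u ∈ fixedUnitStabilizer σ M, ∀ i, D'' i = D' i * ((u i : Kˣ) : K)} =
      {D'' : Fin N → K | ∃ u ∈ fixedUnitStabilizer σ M, ∀ i, D'' i = D i * ((u i : Kˣ) : K)} := by
  obtain ⟨u, hu, hDu⟩ := h
  ext D''
  constructor
  · rintro ⟨u', hu', h'⟩
    exact ⟨u * u', mul_mem hu hu', fun i => by rw [h' i, hDu i, Pi.mul_apply, Units.val_mul, mul_assoc]⟩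
  · rintro ⟨u'', hu'', h''⟩
    refine ⟨u⁻¹ * u'', mul_mem (inv_mem hu) hu'', fun i => ?_⟩
    rw [h'' i, hDu i, Pi.mul_apply, Pi.inv_apply, Units.val_mul, Units.val_inv_eq_inv_val, mul_assoc, mul_inv_cancel_left₀ (u i).ne_zero]

/-! ## §2  The class map and the bijection with `B_F(ρ+s) ⧸ B_F(ρ+s+1)` -/

/-- **THE EXPLICIT SECTION**: for a fixed `f` with (R), the explicit form `D(f) = (D₀(f), −P(Nζ+f), P)` of ★ p856270 §3 is a fixed non-degenerate type-2 polarisation of `latt V` whose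
(R)-parameter `−(D(f)₁ + D(f)₂·Nζ)∕D(f)₂` is `f` itself. [cite: Jacobowitz1962, §7] [cite: Kottwitz1986BaseChangeUnits, §1 pp. 240–241] -/
theorem explicitForm_polarises_and_fParam {σ : K →+* K} (hσ : ∀ a, σ (σ a) = a) (hvσ : ∀ a, Valued.v (σ a) = Valued.v a)
    {ϖ : K} (hϖ0 : ϖ ≠ 0) (hϖ1 : Valued.v ϖ < 1) (hTr : ∀ a : K, Valued.v (a + σ a) ≤ Valued.v ϖ * Valued.v a)
    (ρ s : ℕ) (hρ : 1 ≤ ρ) (hs2 : 2 ∣ s) (hs : 1 ≤ s) {x ζ y'' : K} (hx : Valued.v x = 1) (hζ : Valued.v ζ = 1) (hy'' : Valued.v y'' = Valued.v ϖ ^ s)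
    (V : GL (Fin 3) K) (hV : (V : Matrix (Fin 3) (Fin 3) K) = !![1, 0, 0; x, ϖ ^ ρ, 0; x * ζ + y'', ϖ ^ ρ * ζ, ϖ ^ (2 * ρ + 1 + s)])
    {f : K} (hf : σ f = f) (hR : Valued.v (ζ * σ y'' - σ x * f) ≤ Valued.v ϖ ^ (ρ + s)) :
    let P : K := ((ϖ * σ ϖ) ^ (ρ + s / 2))⁻¹
    let D : Fin 3 → K := ![-(P * ((ζ * σ y'' - σ x * f) * (σ ζ * y'' - x * f)) / f) - (σ x * (-(P * (ζ * σ ζ + f))) * x + σ (x * ζ + y'') * P * (x * ζ + y'')),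
      -(P * (ζ * σ ζ + f)), P]
    ((∀ i, σ (D i) = D i ∧ D i ≠ 0) ∧ IsVertexLattice σ ϖ (Matrix.diagonal D) 2 (latt (V : Matrix (Fin 3) (Fin 3) K))) ∧ -(D 1 + D 2 * (ζ * σ ζ)) / D 2 = f := by
  intro P D
  refine ⟨isVertexLattice_two_latt_hnf_glued_explicit hσ hvσ hϖ0 hϖ1 hTr ρ s hρ hs2 hs hx hζ hy'' V hV hf hR rfl rfl rfl, ?_⟩
  have hσϖ0 : σ ϖ ≠ 0 := fun h => hϖ0 (by rw [← hσ ϖ, h, map_zero])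
  have hP0 : P ≠ 0 := inv_ne_zero (pow_ne_zero _ (mul_ne_zero hϖ0 hσϖ0))
  show -(-(P * (ζ * σ ζ + f)) + P * (ζ * σ ζ)) / P = f
  field_simp
  ring

/-- **THE CLASS COUNT IS AN INDEX: `polarisationCount σ ϖ 2 (latt V) = [B_F(ρ+s) : B_F(ρ+s+1)]`** (`B_F(n) = {a | σa = a, |a| ≤ |ϖ|ⁿ}` in ★ B1's currency
`leAddSubgroup ⊓ ker(σ − id)`).  The map `a ↦ D(f₀+a)·S_F(latt V)` from `B_F(ρ+s)` is constant on `B_F(ρ+s+1)`-cosets and injective modulo them (FILE G2-A2's criterion, as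
`f_{D(f)} = f`), and onto `polarisationCosets` (every polarisation `D` has `f_D ∈ f₀ + B_F(ρ+s)` by G2-A1, and `D ~ D(f_D)`). [cite: Kottwitz1986BaseChangeUnits, §1 pp. 240–241] [cite: Serre1979, Ch. II §2 Prop. 3, Cor. 2–3 (pp. 28–29)] -/
theorem polarisationCount_latt_glued_typeTwo_eq_relIndex {σ : K →+* K} (hσ : ∀ a, σ (σ a) = a) (hvσ : ∀ a, Valued.v (σ a) = Valued.v a)
    (hfix : ∀ x : K, σ x = x → x ≠ 0 → ∃ n : ℤ, Valued.v x = WithZero.exp (2 * n)) {ϖ : K} (hϖ : Valued.v ϖ = WithZero.exp (-1 : ℤ))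
    (hTr : ∀ a : K, Valued.v (a + σ a) ≤ Valued.v ϖ * Valued.v a)
    {ρ : ℕ} (hρ : 1 ≤ ρ) (s : ℕ) (hs2 : 2 ∣ s) (hs : 1 ≤ s) {x ζ y'' : K} (hx : Valued.v x = 1) (hζ : Valued.v ζ = 1) (hy'' : Valued.v y'' = Valued.v ϖ ^ s)
    (V : GL (Fin 3) K) (hV : (V : Matrix (Fin 3) (Fin 3) K) = !![1, 0, 0; x, ϖ ^ ρ, 0; x * ζ + y'', ϖ ^ ρ * ζ, ϖ ^ (2 * ρ + 1 + s)])
    {f₀ : K} (hf₀ : σ f₀ = f₀) (hR₀ : Valued.v (ζ * σ y'' - σ x * f₀) ≤ Valued.v ϖ ^ (ρ + s)) :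
    polarisationCount σ ϖ 2 (latt (V : Matrix (Fin 3) (Fin 3) K)) =
      ((Valued.v : Valuation K ℤᵐ⁰).leAddSubgroup (Valued.v ϖ ^ (ρ + s + 1)) ⊓ (σ.toAddMonoidHom - AddMonoidHom.id K).ker).relIndex
        ((Valued.v : Valuation K ℤᵐ⁰).leAddSubgroup (Valued.v ϖ ^ (ρ + s)) ⊓ (σ.toAddMonoidHom - AddMonoidHom.id K).ker) := by
  obtain ⟨hϖ0, hϖ1⟩ := ne_zero_and_v_lt_one_of_v_eq_exp hϖ
  set M := latt (V : Matrix (Fin 3) (Fin 3) K) with hM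
  set Fx := (σ.toAddMonoidHom - AddMonoidHom.id K).ker with hFx
  set A := (Valued.v : Valuation K ℤᵐ⁰).leAddSubgroup (Valued.v ϖ ^ (ρ + s)) ⊓ Fx with hA
  set A' := (Valued.v : Valuation K ℤᵐ⁰).leAddSubgroup (Valued.v ϖ ^ (ρ + s + 1)) ⊓ Fx with hA'
  have memA : ∀ a : K, a ∈ A ↔ Valued.v a ≤ Valued.v ϖ ^ (ρ + s) ∧ σ a = a := fun a => by
    rw [hA, AddSubgroup.mem_inf, Valuation.mem_leAddSubgroup_iff, hFx, mem_fixedSubgroup_iff]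
  have memA' : ∀ a : K, a ∈ A' ↔ Valued.v a ≤ Valued.v ϖ ^ (ρ + s + 1) ∧ σ a = a := fun a => by
    rw [hA', AddSubgroup.mem_inf, Valuation.mem_leAddSubgroup_iff, hFx, mem_fixedSubgroup_iff]
  -- (R)-parameters `f₀ + a`, `a ∈ A`
  have hRa : ∀ a : K, a ∈ A → σ (f₀ + a) = f₀ + a ∧ Valued.v (ζ * σ y'' - σ x * (f₀ + a)) ≤ Valued.v ϖ ^ (ρ + s) := by
    intro a ha
    obtain ⟨hva, hσa⟩ := (memA a).1 ha
    refine ⟨by rw [map_add, hf₀, hσa], ?_⟩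
    rw [show ζ * σ y'' - σ x * (f₀ + a) = (ζ * σ y'' - σ x * f₀) - σ x * a by ring]
    refine (Valuation.map_sub _ _ _).trans (max_le hR₀ ?_)
    rw [map_mul, hvσ, hx, one_mul]; exact hva
  -- the explicit section
  set P : K := ((ϖ * σ ϖ) ^ (ρ + s / 2))⁻¹ with hP
  set Dsec : K → Fin 3 → K := fun f =>
    ![-(P * ((ζ * σ y'' - σ x * f) * (σ ζ * y'' - x * f)) / f) - (σ x * (-(P * (ζ * σ ζ + f))) * x + σ (x * ζ + y'') * P * (x * ζ + y'')),
      -(P * (ζ * σ ζ + f)), P] with hDsec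
  have hsec : ∀ f : K, σ f = f → Valued.v (ζ * σ y'' - σ x * f) ≤ Valued.v ϖ ^ (ρ + s) →
      ((∀ i, σ (Dsec f i) = Dsec f i ∧ Dsec f i ≠ 0) ∧ IsVertexLattice σ ϖ (Matrix.diagonal (Dsec f)) 2 M) ∧ -(Dsec f 1 + Dsec f 2 * (ζ * σ ζ)) / Dsec f 2 = f :=
    fun f hf hR => explicitForm_polarises_and_fParam hσ hvσ hϖ0 hϖ1 hTr ρ s hρ hs2 hs hx hζ hy'' V hV hf hR
  -- the class of a form
  set coset : (Fin 3 → K) → Set (Fin 3 → K) := fun D => {D' : Fin 3 → K | ∃ u ∈ fixedUnitStabilizer σ M, ∀ i, D' i = D i * ((u i : Kˣ) : K)} with hcoset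
  -- the class map on `A`, constant on `A'`-cosets
  set g₀ : A → Set (Fin 3 → K) := fun a => coset (Dsec (f₀ + a)) with hg₀
  have hrel : ∀ a b : A, Valued.v ((f₀ + a) - (f₀ + b)) ≤ Valued.v ϖ ^ (ρ + s + 1) ↔ -a + b ∈ A'.addSubgroupOf A := by
    intro a b
    rw [AddSubgroup.mem_addSubgroupOf, memA', AddSubgroup.coe_add, AddSubgroup.coe_neg,
      show (f₀ + a : K) - (f₀ + b) = -(-(a : K) + b) by ring, Valuation.map_neg]
    have hσ' : σ (-(a : K) + b) = -(a : K) + b := by rw [map_add, map_neg, ((memA a).1 a.2).2, ((memA b).1 b.2).2]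
    exact ⟨fun h => ⟨h, hσ'⟩, fun h => h.1⟩
  have key : ∀ a b : A, (∃ u ∈ fixedUnitStabilizer σ M, ∀ i, Dsec (f₀ + b) i = Dsec (f₀ + a) i * ((u i : Kˣ) : K)) ↔ -a + b ∈ A'.addSubgroupOf A := by
    intro a b
    obtain ⟨⟨hDa, hva⟩, hpa⟩ := hsec (f₀ + a) (hRa a a.2).1 (hRa a a.2).2
    obtain ⟨⟨hDb, hvb⟩, hpb⟩ := hsec (f₀ + b) (hRa b b.2).1 (hRa b b.2).2
    rw [exists_stabiliser_iff_v_fParam_sub_le hσ hvσ hfix hϖ hρ s hs2 hs hx hζ hy'' V hV hDa hva hDb hvb hpa.symm hpb.symm]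
    exact hrel a b
  have hg₀ : ∀ a b : A, (QuotientAddGroup.leftRel (A'.addSubgroupOf A)) a b → g₀ a = g₀ b := by
    intro a b hab
    rw [QuotientAddGroup.leftRel_apply] at hab
    exact (coset_eq_of_exists σ M ((key a b).2 hab)).symm
  set g : A ⧸ A'.addSubgroupOf A → Set (Fin 3 → K) := fun q => Quotient.liftOn' q g₀ hg₀ with hg
  have hgmk : ∀ a : A, g (a : A ⧸ A'.addSubgroupOf A) = coset (Dsec (f₀ + a)) := fun a => rfl
  -- injective
  have hinj : Function.Injective g := by
    intro q₁ q₂ h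
    induction q₁ using QuotientAddGroup.induction_on with
    | H a =>
      induction q₂ using QuotientAddGroup.induction_on with
      | H b =>
        rw [hgmk, hgmk] at h
        refine QuotientAddGroup.eq.2 ((key a b).1 ?_)
        have hmem : Dsec (f₀ + b) ∈ coset (Dsec (f₀ + a)) := by rw [h]; exact mem_coset_self σ M _
        exact hmem
  -- onto `polarisationCosets`
  have hrange : Set.range g = polarisationCosets σ ϖ 2 M := by
    ext C
    constructor
    · rintro ⟨q, rfl⟩
      induction q using QuotientAddGroup.induction_on with
      | H a =>
        rw [hgmk]
        exact ⟨Dsec (f₀ + a), (hsec (f₀ + a) (hRa a a.2).1 (hRa a a.2).2).1, rfl⟩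
    · rintro ⟨D, ⟨hD, hvert⟩, rfl⟩
      -- the (R)-parameter of `D` lies in `f₀ + A`
      obtain ⟨⟨hf, hR, -⟩, -, -, -⟩ := structure_of_polarisation hσ hvσ hfix hϖ hρ s hs2 hs hx hζ hy'' V hV hD hvert rfl
      set f : K := -(D 1 + D 2 * (ζ * σ ζ)) / D 2 with hfdef
      have ha : f - f₀ ∈ A := by
        rw [memA]
        refine ⟨?_, by rw [map_sub, hf, hf₀]⟩
        have e : f - f₀ = -((ζ * σ y'' - σ x * f) - (ζ * σ y'' - σ x * f₀)) / σ x := by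
          have hσx : σ x ≠ 0 := fun h => by rw [← hvσ x, h, map_zero] at hx; exact zero_ne_one hx
          field_simp; ring
        rw [e, map_div₀, Valuation.map_neg, hvσ, hx, div_one]
        exact (Valuation.map_sub _ _ _).trans (max_le hR hR₀)
      refine ⟨((⟨f - f₀, ha⟩ : A) : A ⧸ A'.addSubgroupOf A), ?_⟩
      rw [hgmk]
      -- `D ~ D(f)` since both have (R)-parameter `f`
      have hfa : f₀ + (f - f₀) = f := by ring
      simp only [hfa]
      obtain ⟨⟨hDf, hvf⟩, hpf⟩ := hsec f hf hR
      refine coset_eq_of_exists σ M ((exists_stabiliser_iff_v_fParam_sub_le hσ hvσ hfix hϖ hρ s hs2 hs hx hζ hy'' V hV hD hvert hDf hvf rfl hpf.symm).2 ?_)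
      rw [sub_self, map_zero]; exact zero_le
  -- count
  rw [polarisationCount_eq, ← hrange, Set.ncard_range_of_injective hinj, ← AddSubgroup.index_eq_card]
  rfl

/-! ## §3  The values -/

/-- **`[B_F(n) : B_F(n+1)] = q` for `n` EVEN**: `B_F(n+1) = B_F(n+2)` by parity of fixed valuations, and `[B_F(n) : B_F(n+2)] = q` (★ B1 `relIndex_fixedBall_step`).
[cite: Serre1979, Ch. II §2 Prop. 3, Cor. 2–3 (pp. 28–29)] [cite: Serre1979, Ch. I §6 Prop. 18] -/
theorem relIndex_fixedBall_succ_of_even {σ : K →+* K} (hσ : ∀ a, σ (σ a) = a) (hvσ : ∀ a, Valued.v (σ a) = Valued.v a)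
    (hfix : ∀ x : K, σ x = x → x ≠ 0 → ∃ n : ℤ, Valued.v x = WithZero.exp (2 * n)) {ϖ : K} (hϖ : Valued.v ϖ = WithZero.exp (-1 : ℤ))
    {d : ℕ} (hd : Valued.v (ϖ - σ ϖ) = Valued.v ϖ ^ d) [Finite 𝓀[K]] (n : ℕ) (hn : 2 ∣ n) :
    ((Valued.v : Valuation K ℤᵐ⁰).leAddSubgroup (Valued.v ϖ ^ (n + 1)) ⊓ (σ.toAddMonoidHom - AddMonoidHom.id K).ker).relIndex
        ((Valued.v : Valuation K ℤᵐ⁰).leAddSubgroup (Valued.v ϖ ^ n) ⊓ (σ.toAddMonoidHom - AddMonoidHom.id K).ker) = Nat.card 𝓀[K] := by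
  obtain ⟨m, rfl⟩ := hn
  rw [v_pow_eq_exp_neg hϖ, v_pow_eq_exp_neg hϖ]
  have hpar := fixedBall_inf_odd_eq (σ := σ) hfix (-(m : ℤ) - 1)
  rw [show 2 * (-(m : ℤ) - 1) + 1 = -((2 * m + 1 : ℕ) : ℤ) by push_cast; ring] at hpar
  rw [hpar]
  have hstep := relIndex_fixedBall_step hσ hvσ hfix hϖ hd (-((2 * m : ℕ) : ℤ))
  rw [show (-((2 * m : ℕ) : ℤ)) - 2 = 2 * (-(m : ℤ) - 1) by push_cast; ring] at hstep
  exact hstep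

/-- **`[B_F(n) : B_F(n+1)] = 1` for `n` ODD**: `B_F(n) = B_F(n+1)` by parity of fixed valuations. [cite: Serre1979, Ch. I §6 Prop. 18] -/
theorem relIndex_fixedBall_succ_of_odd {σ : K →+* K} (hfix : ∀ x : K, σ x = x → x ≠ 0 → ∃ n : ℤ, Valued.v x = WithZero.exp (2 * n))
    {ϖ : K} (hϖ : Valued.v ϖ = WithZero.exp (-1 : ℤ)) (n : ℕ) (hn : ¬ 2 ∣ n) :
    ((Valued.v : Valuation K ℤᵐ⁰).leAddSubgroup (Valued.v ϖ ^ (n + 1)) ⊓ (σ.toAddMonoidHom - AddMonoidHom.id K).ker).relIndex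
        ((Valued.v : Valuation K ℤᵐ⁰).leAddSubgroup (Valued.v ϖ ^ n) ⊓ (σ.toAddMonoidHom - AddMonoidHom.id K).ker) = 1 := by
  obtain ⟨m, rfl⟩ := Nat.odd_iff.2 (Nat.mod_two_ne_zero.1 fun h => hn (Nat.dvd_of_mod_eq_zero h))
  rw [v_pow_eq_exp_neg hϖ, v_pow_eq_exp_neg hϖ]
  have hpar := fixedBall_inf_odd_eq (σ := σ) hfix (-(m : ℤ) - 1)
  rw [show 2 * (-(m : ℤ) - 1) + 1 = -((2 * m + 1 : ℕ) : ℤ) by push_cast; ring, show 2 * (-(m : ℤ) - 1) = -((2 * m + 1 + 1 : ℕ) : ℤ) by push_cast; ring] at hpar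
  rw [hpar]
  exact AddSubgroup.relIndex_self _

/-- **THE TYPE-2 MULTIPLICITY OF THE GLUED STRATUM, `ρ` EVEN: `polarisationCount σ ϖ 2 (latt V) = q`** (`V = (1 0 0; x ϖ^ρ 0; xζ+y″ ϖ^ρζ ϖ^{2ρ+1+s})`, `|x| = |ζ| = 1`,
`|y″| = |ϖ|^s`, `ρ ≥ 2` even, `s ≥ 2` even, (R) for some fixed `f₀`): the `q` classes `D(f₀ + r)·S_F`, `r` over `B_F(ρ+s) ⧸ B_F(ρ+s+1) ≅ 𝓀` — LH4-p09 (g2)'s table «ρ even ≥ 2 → q»,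
of which ★ p856297 exhibited two. [cite: Kottwitz1986BaseChangeUnits, §1 pp. 240–241] [cite: Serre1979, Ch. II §2 Prop. 3, Cor. 2–3 (pp. 28–29)] -/
theorem polarisationCount_latt_glued_typeTwo_eq_card {σ : K →+* K} (hσ : ∀ a, σ (σ a) = a) (hvσ : ∀ a, Valued.v (σ a) = Valued.v a)
    (hfix : ∀ x : K, σ x = x → x ≠ 0 → ∃ n : ℤ, Valued.v x = WithZero.exp (2 * n)) {ϖ : K} (hϖ : Valued.v ϖ = WithZero.exp (-1 : ℤ))
    {d : ℕ} (hd : Valued.v (ϖ - σ ϖ) = Valued.v ϖ ^ d) [Finite 𝓀[K]] (hTr : ∀ a : K, Valued.v (a + σ a) ≤ Valued.v ϖ * Valued.v a)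
    {ρ : ℕ} (hρ : 1 ≤ ρ) (hρ2 : 2 ∣ ρ) (s : ℕ) (hs2 : 2 ∣ s) (hs : 1 ≤ s) {x ζ y'' : K} (hx : Valued.v x = 1) (hζ : Valued.v ζ = 1) (hy'' : Valued.v y'' = Valued.v ϖ ^ s)
    (V : GL (Fin 3) K) (hV : (V : Matrix (Fin 3) (Fin 3) K) = !![1, 0, 0; x, ϖ ^ ρ, 0; x * ζ + y'', ϖ ^ ρ * ζ, ϖ ^ (2 * ρ + 1 + s)])
    {f₀ : K} (hf₀ : σ f₀ = f₀) (hR₀ : Valued.v (ζ * σ y'' - σ x * f₀) ≤ Valued.v ϖ ^ (ρ + s)) :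
    polarisationCount σ ϖ 2 (latt (V : Matrix (Fin 3) (Fin 3) K)) = Nat.card 𝓀[K] := by
  rw [polarisationCount_latt_glued_typeTwo_eq_relIndex hσ hvσ hfix hϖ hTr hρ s hs2 hs hx hζ hy'' V hV hf₀ hR₀]
  exact relIndex_fixedBall_succ_of_even hσ hvσ hfix hϖ hd (ρ + s) ((Nat.dvd_add_right hρ2).2 hs2)

/-- **THE TYPE-2 MULTIPLICITY OF THE GLUED STRATUM, `ρ` ODD: `polarisationCount σ ϖ 2 (latt V) = 1`** (same frame and hypotheses, `ρ` odd): all type-2 polarisations of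
`latt V` form ONE `S_F`-class — LH4-p09 (g2)'s table «ρ odd → 1», the surviving half of «UNIQ₂» on the glued strata. [cite: Kottwitz1986BaseChangeUnits, §1 pp. 240–241] [cite: Serre1979, Ch. I §6 Prop. 18] -/
theorem polarisationCount_latt_glued_typeTwo_eq_one {σ : K →+* K} (hσ : ∀ a, σ (σ a) = a) (hvσ : ∀ a, Valued.v (σ a) = Valued.v a)
    (hfix : ∀ x : K, σ x = x → x ≠ 0 → ∃ n : ℤ, Valued.v x = WithZero.exp (2 * n)) {ϖ : K} (hϖ : Valued.v ϖ = WithZero.exp (-1 : ℤ))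
    (hTr : ∀ a : K, Valued.v (a + σ a) ≤ Valued.v ϖ * Valued.v a)
    {ρ : ℕ} (hρ : 1 ≤ ρ) (hρ2 : ¬ 2 ∣ ρ) (s : ℕ) (hs2 : 2 ∣ s) (hs : 1 ≤ s) {x ζ y'' : K} (hx : Valued.v x = 1) (hζ : Valued.v ζ = 1) (hy'' : Valued.v y'' = Valued.v ϖ ^ s)
    (V : GL (Fin 3) K) (hV : (V : Matrix (Fin 3) (Fin 3) K) = !![1, 0, 0; x, ϖ ^ ρ, 0; x * ζ + y'', ϖ ^ ρ * ζ, ϖ ^ (2 * ρ + 1 + s)])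
    {f₀ : K} (hf₀ : σ f₀ = f₀) (hR₀ : Valued.v (ζ * σ y'' - σ x * f₀) ≤ Valued.v ϖ ^ (ρ + s)) :
    polarisationCount σ ϖ 2 (latt (V : Matrix (Fin 3) (Fin 3) K)) = 1 := by
  rw [polarisationCount_latt_glued_typeTwo_eq_relIndex hσ hvσ hfix hϖ hTr hρ s hs2 hs hx hζ hy'' V hV hf₀ hR₀]
  refine relIndex_fixedBall_succ_of_odd hfix hϖ (ρ + s) fun h => hρ2 ?_
  exact (Nat.dvd_add_right hs2).1 (by rwa [add_comm] at h)

/-- **BOTH PARITIES IN ONE LINE: `polarisationCount σ ϖ 2 (latt V) = q^{1 − ρ % 2}`** (`ρ ≥ 1`; the letter of F0P3-p01 (g31)'s socket₂ binder `hmult` at `ρ ≥ 1`).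
[cite: Kottwitz1986BaseChangeUnits, §1 pp. 240–241] -/
theorem polarisationCount_latt_glued_typeTwo_eq_pow {σ : K →+* K} (hσ : ∀ a, σ (σ a) = a) (hvσ : ∀ a, Valued.v (σ a) = Valued.v a)
    (hfix : ∀ x : K, σ x = x → x ≠ 0 → ∃ n : ℤ, Valued.v x = WithZero.exp (2 * n)) {ϖ : K} (hϖ : Valued.v ϖ = WithZero.exp (-1 : ℤ))
    {d : ℕ} (hd : Valued.v (ϖ - σ ϖ) = Valued.v ϖ ^ d) [Finite 𝓀[K]] (hTr : ∀ a : K, Valued.v (a + σ a) ≤ Valued.v ϖ * Valued.v a)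
    {ρ : ℕ} (hρ : 1 ≤ ρ) (s : ℕ) (hs2 : 2 ∣ s) (hs : 1 ≤ s) {x ζ y'' : K} (hx : Valued.v x = 1) (hζ : Valued.v ζ = 1) (hy'' : Valued.v y'' = Valued.v ϖ ^ s)
    (V : GL (Fin 3) K) (hV : (V : Matrix (Fin 3) (Fin 3) K) = !![1, 0, 0; x, ϖ ^ ρ, 0; x * ζ + y'', ϖ ^ ρ * ζ, ϖ ^ (2 * ρ + 1 + s)])
    {f₀ : K} (hf₀ : σ f₀ = f₀) (hR₀ : Valued.v (ζ * σ y'' - σ x * f₀) ≤ Valued.v ϖ ^ (ρ + s)) :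
    polarisationCount σ ϖ 2 (latt (V : Matrix (Fin 3) (Fin 3) K)) = Nat.card 𝓀[K] ^ (1 - ρ % 2) := by
  by_cases hρ2 : 2 ∣ ρ
  · rw [polarisationCount_latt_glued_typeTwo_eq_card hσ hvσ hfix hϖ hd hTr hρ hρ2 s hs2 hs hx hζ hy'' V hV hf₀ hR₀, Nat.dvd_iff_mod_eq_zero.1 hρ2, Nat.sub_zero, pow_one]
  · rw [polarisationCount_latt_glued_typeTwo_eq_one hσ hvσ hfix hϖ hTr hρ hρ2 s hs2 hs hx hζ hy'' V hV hf₀ hR₀, Nat.mod_two_ne_zero.1 (fun h => hρ2 (Nat.dvd_of_mod_eq_zero h)),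
      Nat.sub_self, pow_zero]

/-- **OFF (R) THE MULTIPLICITY VANISHES**: if no fixed `f` satisfies (R) then `latt V` is not type-2 polarisable (★ p856270 `isTypeTwoPolarisable_latt_hnf_glued_iff`), so
`polarisationCount σ ϖ 2 (latt V) = 0` (★ `polarisationCount_two_eq_zero_of_not_isTypeTwoPolarisable`). [cite: Kottwitz1986BaseChangeUnits, §1 pp. 240–241] -/
theorem polarisationCount_latt_glued_typeTwo_eq_zero {σ : K →+* K} (hσ : ∀ a, σ (σ a) = a) (hvσ : ∀ a, Valued.v (σ a) = Valued.v a)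
    {ϖ : K} (hϖ0 : ϖ ≠ 0) (hϖ1 : Valued.v ϖ < 1) (hTr : ∀ a : K, Valued.v (a + σ a) ≤ Valued.v ϖ * Valued.v a)
    (ρ s : ℕ) (hρ : 1 ≤ ρ) (hs2 : 2 ∣ s) (hs : 1 ≤ s) {x ζ y'' : K} (hx : Valued.v x = 1) (hζ : Valued.v ζ = 1) (hy'' : Valued.v y'' = Valued.v ϖ ^ s)
    (V : GL (Fin 3) K) (hV : (V : Matrix (Fin 3) (Fin 3) K) = !![1, 0, 0; x, ϖ ^ ρ, 0; x * ζ + y'', ϖ ^ ρ * ζ, ϖ ^ (2 * ρ + 1 + s)])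
    (hnoR : ¬ ∃ f : K, σ f = f ∧ Valued.v (ζ * σ y'' - σ x * f) ≤ Valued.v ϖ ^ (ρ + s)) :
    polarisationCount σ ϖ 2 (latt (V : Matrix (Fin 3) (Fin 3) K)) = 0 :=
  polarisationCount_two_eq_zero_of_not_isTypeTwoPolarisable σ ϖ _
    (fun h => hnoR ((isTypeTwoPolarisable_latt_hnf_glued_iff hσ hvσ hϖ0 hϖ1 hTr ρ s hρ hs2 hs hx hζ hy'' V hV).1 h))

end Summit.HodgeConjecture.HodgeConjecture.Cruxes.H413.F0P3cDyRamDiagonalGluedPolarisationCountTypeTwo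

end
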